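import Summits.Ventures.CertifiedArithmetic.LowPrec.GemmEnvelopeOnset

/-!
# GEMM-level envelopes, part (v): THE OUTPUT-LEVEL ONSET OF ROW P5 IS EXACTLY `κ_Π` (pub-lowprec gemm gen 23, LXXI-b)

HONEST FRAMING: certified error envelopes and provably optimal rounding/accumulation schemes for
low-precision formats under stated cost models; every table by two implementations; no hardware or vendor
claims.

Instances of the generic onset law of part (u) `GemmEnvelopeOnset` for row P5 (MX-E4M3-ceil against the
per-vector constant `C_Π = 35/289 + (γ̄ + δ̄(1 + γ̄))·324/289`), the cell's candidates L20a/L20b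
(THEOREM-SHAPES v7.10 §4.2).  With `κ_Π² = 14336²·(1 + C_Π)/((1 - γ̄)(1 - δ̄)) = 137506330902528/591583` at
the caps `(γ̄, δ̄) = (1/2048, 1/257)` (`κ_Π ≈ 15245.92`; `θ = 258048/17 ≈ 15179.29 < κ_Π < 229376/15`):

* `row_P5_no_output_witness` (generic caps `0 ≤ γ̄, δ̄ ≤ 1`, constant `C ≥ 0`, `κ ≤ 229376/15`,
  `R ≥ max(18/17, κ/14336)`, `(1 - γ̄)(1 - δ̄)R² ≤ 1 + C`, `1 - (1 - δ̄)(1 + γ̄)·256/289 ≤ C`): EVERY input of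
  `C(κ)` admits a realisation with `|c - S| ≤ C·L`;  `row_P5_no_output_witness_below`: the instance
  `591583·κ² ≤ 137506330902528` at the caps and `C_Π` — NO input of `C(κ)` is an output-level witness, for
  every `B`, `k` (the new content is the window `258048/17 < κ ≤ κ_Π`; below `θ` every realisation stays
  inside, part (o)).
* `mxCeil_blocked_le_ratio`: the `(0, 0)` instance is the exact-accumulation MX envelope in ratio form,
  `|ΣΣ q̂a q̂b - S| ≤ (R² - 1)·L` — `35/289` up to `θ` (part (n)) and `(κ/14336)² - 1` on
  `θ ≤ κ ≤ 229376/15` (announced in part (n)); `mxCeil_ratio_envelope_approached`: every `q ≥ 0` with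
  `(q + 1)·14336² < κ²` is exceeded on `C(κ)` (blocks `≥ 3`), so that value is the exact envelope there.
* `row_P5_output_witness` (generic caps `0 ≤ γ̄ < 1`, `0 ≤ δ̄ < 1`, `C ≥ 0`, onset
  `14336²(1 + C) < (1 - γ̄)(1 - δ̄)κ²`, first-rung condition `225(1 + C) < 256(1 - γ̄)(1 - δ̄)`, i.e.
  `R_Π < 16/15`): for blocks of length `≥ 3` the pinned input `(A, 0, v, …)·(0, A, v, …)`,
  `max(224/κ, 15/1024) < v`, `v² < (1 - γ̄)(1 - δ̄)/(4096(1 + C))`, `A = min(κv, 448)`, separates for EVERY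
  realisation;  `row_P5_output_onset_above`: the instance at the caps — for EVERY `κ > 0` with
  `137506330902528 < 591583·κ²` (no upper bound on `κ`).  So the output-level onset of row P5 is EXACTLY
  `κ_Π`, and the corner values `κ_Π(0,0) = θ`, `κ_Π(γ̄,0) ≈ 15186.71`, `κ_Π(0,δ̄) ≈ 15238.47` of the cell's
  table are instances of the same two generic theorems.  `0 < κ` is necessary in the witness half: `C(κ)`
  contains only zero inputs for `κ < 0`.

Exact rational algebra over the kernel definitions; caps are hypotheses, not device claims.  No `sorry`;
axioms `propext`, `Classical.choice`, `Quot.sound` only.  [cite: RouhaniEtAl2023MX, §5.1]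
[cite: MicikeviciusEtAl2022, §3] [cite: Higham2002ASNA, §3.1]
-/

namespace Summit.Ventures.CertifiedArithmetic.LowPrec.GemmEnvelope

open Finset
open Literature.ComputerArithmetic.FloatingPoint
open Literature.ComputerArithmetic.FloatingPoint.Format
open Literature.ComputerArithmetic.FloatingPoint.MiniFloat
open Literature.ComputerArithmetic.FloatingPoint.MXBlock
open Summit.Ventures.CertifiedArithmetic.LowPrec.SR

/-! ## Row P5: the no-witness half below the onset -/

/-- **ROW P5, NO OUTPUT-LEVEL WITNESS (generic caps and constant).**  On `C(κ)`, `κ ≤ 229376/15`,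
`18/17 ≤ R`, `κ ≤ 14336·R`, for caps `0 ≤ γ̄ ≤ 1`, `0 ≤ δ̄ ≤ 1` and a constant `C ≥ 0` with
`(1 - γ̄)(1 - δ̄)·R² ≤ 1 + C` and `1 - (1 - δ̄)(1 + γ̄)·256/289 ≤ C`, EVERY input admits a realisation of the
MX-E4M3-ceil pipeline with `|c - S| ≤ C·L`.  With `R = max(18/17, κ/14336)` the first condition reads
`κ ≤ κ_Π(γ̄, δ̄; C) := 14336·√((1 + C)/((1 - γ̄)(1 - δ̄)))` (for `κ_Π ≥ 258048/17`).
[cite: RouhaniEtAl2023MX, §5.1] [cite: Higham2002ASNA, §3.1] -/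
theorem row_P5_no_output_witness {B k : ℕ} (a b : Fin B → Fin k → ℚ) {Aa Ab κ R γ δ C : ℚ}
    (hκM : κ ≤ 229376 / 15) (hR : 18 / 17 ≤ R) (hκR : κ ≤ 14336 * R)
    (hC : 0 ≤ C) (hγ0 : 0 ≤ γ) (hγ1 : γ ≤ 1) (hδ0 : 0 ≤ δ) (hδ1 : δ ≤ 1)
    (hup : (1 - γ) * (1 - δ) * R ^ 2 ≤ 1 + C) (hdn : 1 - (1 - δ) * (1 + γ) * (256 / 289) ≤ C)
    (ha : ∀ j i, |a j i| ≤ Aa ∧ (a j i = 0 ∨ Aa ≤ κ * |a j i|))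
    (hb : ∀ j i, |b j i| ≤ Ab ∧ (b j i = 0 ∨ Ab ≤ κ * |b j i|)) :
    ∃ acc c : ℚ,
      |acc - ∑ j, ∑ i, (ceilScale E4M3 (a j) * (roundNE E4M3 (a j i / ceilScale E4M3 (a j))).toRat) *
          (ceilScale E4M3 (b j) * (roundNE E4M3 (b j i / ceilScale E4M3 (b j))).toRat)|
        ≤ γ * ∑ j, ∑ i, |(ceilScale E4M3 (a j) * (roundNE E4M3 (a j i / ceilScale E4M3 (a j))).toRat) *
          (ceilScale E4M3 (b j) * (roundNE E4M3 (b j i / ceilScale E4M3 (b j))).toRat)| ∧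
      |c - acc| ≤ δ * |acc| ∧
      |c - ∑ j, ∑ i, a j i * b j i| ≤ C * ∑ j, ∑ i, |a j i * b j i| := by
  have key := no_output_witness_of_ratio_band (ι := Fin B × Fin k) (fun x => a x.1 x.2 * b x.1 x.2)
    (fun x => (ceilScale E4M3 (a x.1) * (roundNE E4M3 (a x.1 x.2 / ceilScale E4M3 (a x.1))).toRat) *
      (ceilScale E4M3 (b x.1) * (roundNE E4M3 (b x.1 x.2 / ceilScale E4M3 (b x.1))).toRat))
    (rlo := 256 / 289) (rhi := R ^ 2) (γ := γ) (δ := δ) (C := C) hC hγ0 hγ1 hδ0 hδ1 (by norm_num)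
    (fun x => mxCeil_cell_ratio (a x.1) (b x.1) x.2 (class_blockMax_le a ha x.1 x.2)
      (class_blockMax_le b hb x.1 x.2) hκM hR hκR) hup hdn
  simp only [Fintype.sum_prod_type] at key
  exact key

/-- **ROW P5 BELOW THE ONSET `κ_Π` (cell candidate L20b `RowP5NoOutputWitnessBelow`).**  At the caps
`(γ̄, δ̄) = (1/2048, 1/257)` and the per-vector constant `C_Π`, for every `κ` with
`591583·κ² ≤ 137506330902528` (`κ ≤ κ_Π ≈ 15245.92`; `κ_Π² = 14336²·(1 + C_Π)/((1 - γ̄)(1 - δ̄))`) NO input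
of `C(κ)` is an output-level witness of `¬(MXC ≼ VEC)`: some realisation has `|c - S| ≤ C_Π·L` — for every
`B` and `k`.  (For `κ ≤ 258048/17` every realisation does, part (o); the new content is the window
`258048/17 < κ ≤ κ_Π`.) [cite: RouhaniEtAl2023MX, §5.1] [cite: MicikeviciusEtAl2022, §3] -/
theorem row_P5_no_output_witness_below {B k : ℕ} {κ : ℚ} (hκ : 591583 * κ ^ 2 ≤ 137506330902528)
    (a b : Fin B → Fin k → ℚ) {Aa Ab : ℚ}
    (ha : ∀ j i, |a j i| ≤ Aa ∧ (a j i = 0 ∨ Aa ≤ κ * |a j i|))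
    (hb : ∀ j i, |b j i| ≤ Ab ∧ (b j i = 0 ∨ Ab ≤ κ * |b j i|)) :
    ∃ acc c : ℚ,
      |acc - ∑ j, ∑ i, (ceilScale E4M3 (a j) * (roundNE E4M3 (a j i / ceilScale E4M3 (a j))).toRat) *
          (ceilScale E4M3 (b j) * (roundNE E4M3 (b j i / ceilScale E4M3 (b j))).toRat)|
        ≤ 1 / 2048 * ∑ j, ∑ i, |(ceilScale E4M3 (a j) * (roundNE E4M3 (a j i / ceilScale E4M3 (a j))).toRat) *
          (ceilScale E4M3 (b j) * (roundNE E4M3 (b j i / ceilScale E4M3 (b j))).toRat)| ∧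
      |c - acc| ≤ 1 / 257 * |acc| ∧
      |c - ∑ j, ∑ i, a j i * b j i|
        ≤ (35 / 289 + 1 / 2048 * (324 / 289) + 1 / 257 * (324 / 289) * (1 + 1 / 2048))
          * ∑ j, ∑ i, |a j i * b j i| := by
  by_cases hθ : κ ≤ 258048 / 17
  · exact row_P5_no_output_witness a b (R := 18 / 17) (by linarith) le_rfl (by linarith) (by norm_num)
      (by norm_num) (by norm_num) (by norm_num) (by norm_num) (by norm_num) (by norm_num) ha hb
  · push Not at hθ
    have hκpos : 0 < κ := by linarith
    have hκM : κ ≤ 229376 / 15 := by nlinarith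
    exact row_P5_no_output_witness a b (R := κ / 14336) hκM (by linarith) (by linarith) (by norm_num)
      (by norm_num) (by norm_num) (by norm_num) (by norm_num) (by rw [div_pow]; linarith) (by norm_num) ha hb

/-- The `(γ̄, δ̄) = (0, 0)` instance of the no-witness half is the EXACT-ACCUMULATION MX ENVELOPE in ratio
form: on `C(κ)`, `κ ≤ 229376/15`, `|ΣΣ q̂a q̂b - S| ≤ (R² - 1)·L` for every `R ≥ 18/17` with `κ ≤ 14336·R`
— i.e. `35/289` up to `θ = 258048/17` (part (n)) and `(κ/14336)² - 1` on `θ ≤ κ ≤ 229376/15`.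
[cite: RouhaniEtAl2023MX, §5.1] -/
theorem mxCeil_blocked_le_ratio {B k : ℕ} (a b : Fin B → Fin k → ℚ) {Aa Ab κ R : ℚ}
    (hκM : κ ≤ 229376 / 15) (hR : 18 / 17 ≤ R) (hκR : κ ≤ 14336 * R)
    (ha : ∀ j i, |a j i| ≤ Aa ∧ (a j i = 0 ∨ Aa ≤ κ * |a j i|))
    (hb : ∀ j i, |b j i| ≤ Ab ∧ (b j i = 0 ∨ Ab ≤ κ * |b j i|)) :
    |∑ j, ∑ i, (ceilScale E4M3 (a j) * (roundNE E4M3 (a j i / ceilScale E4M3 (a j))).toRat) *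
        (ceilScale E4M3 (b j) * (roundNE E4M3 (b j i / ceilScale E4M3 (b j))).toRat)
        - ∑ j, ∑ i, a j i * b j i| ≤ (R ^ 2 - 1) * ∑ j, ∑ i, |a j i * b j i| := by
  have hR2 : 324 / 289 ≤ R ^ 2 := by nlinarith
  obtain ⟨acc, c, hacc, hc, hS⟩ := row_P5_no_output_witness a b (γ := 0) (δ := 0) (C := R ^ 2 - 1)
    hκM hR hκR (by linarith) le_rfl (by norm_num) le_rfl (by norm_num) (by linarith) (by norm_num; linarith)
    ha hb
  rw [zero_mul] at hacc hc
  have e1 := abs_nonpos_iff.mp hacc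
  have e2 := abs_nonpos_iff.mp hc
  rw [sub_eq_zero] at e1 e2
  rw [e2, e1] at hS
  exact hS

/-! ## Row P5: the witness half above the onset -/

/-- **ROW P5, OUTPUT-LEVEL WITNESS ABOVE THE ONSET (generic caps and constant).**  Caps `0 ≤ γ̄ < 1`,
`0 ≤ δ̄ < 1`, constant `C ≥ 0`; if `14336²·(1 + C) < (1 - γ̄)(1 - δ̄)·κ²` (`κ > κ_Π(γ̄, δ̄; C)`, `κ > 0`) and the
onset sits on the first sliver rung, `225·(1 + C) < 256·(1 - γ̄)(1 - δ̄)` (i.e. `R_Π < 16/15`; automatic for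
`κ ≤ 229376/15`), then for blocks of length `≥ 3` the pinned MX input `(A, 0, v, …)·(0, A, v, …)`,
`max(224/κ, 15/1024) < v`, `v² < (1 - γ̄)(1 - δ̄)/(4096(1 + C))`, `A = min(κv, 448)` (scale `1`, `v ↦ 1/64`)
lies in `C(κ)` and has `C·L < |c - S|` for EVERY realisation. [cite: RouhaniEtAl2023MX, §5.1]
[cite: Higham2002ASNA, §3.1] -/
theorem row_P5_output_witness {B k : ℕ} (hB : 0 < B) (hk : 3 ≤ k) {κ γb δb C : ℚ} (hκ0 : 0 < κ)
    (hγb0 : 0 ≤ γb) (hγb : γb < 1) (hδb0 : 0 ≤ δb) (hδb : δb < 1) (hC : 0 ≤ C)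
    (honset : 14336 ^ 2 * (1 + C) < (1 - γb) * (1 - δb) * κ ^ 2)
    (hrung : 225 * (1 + C) < 256 * ((1 - γb) * (1 - δb))) :
    ∃ (a b : Fin B → Fin k → ℚ) (Aa Ab : ℚ),
      (∀ j i, |a j i| ≤ Aa ∧ (a j i = 0 ∨ Aa ≤ κ * |a j i|)) ∧
      (∀ j i, |b j i| ≤ Ab ∧ (b j i = 0 ∨ Ab ≤ κ * |b j i|)) ∧
      ∀ (γ δ acc c : ℚ), γ ≤ γb → δ ≤ δb →
        |acc - ∑ j, ∑ i, (ceilScale E4M3 (a j) * (roundNE E4M3 (a j i / ceilScale E4M3 (a j))).toRat) *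
            (ceilScale E4M3 (b j) * (roundNE E4M3 (b j i / ceilScale E4M3 (b j))).toRat)|
          ≤ γ * ∑ j, ∑ i, |(ceilScale E4M3 (a j) * (roundNE E4M3 (a j i / ceilScale E4M3 (a j))).toRat) *
            (ceilScale E4M3 (b j) * (roundNE E4M3 (b j i / ceilScale E4M3 (b j))).toRat)| →
        |c - acc| ≤ δ * |acc| →
        C * ∑ j, ∑ i, |a j i * b j i| < |c - ∑ j, ∑ i, a j i * b j i| := by
  obtain ⟨n, rfl⟩ : ∃ n, k = n + 3 := ⟨k - 3, by omega⟩
  have hM : E4M3.maxRat = 448 := by decide +kernel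
  have hMpos : 0 < E4M3.maxRat := by rw [hM]; norm_num
  have hC1 : 0 < 1 + C := by linarith
  have h1γδ : 0 < (1 - γb) * (1 - δb) := mul_pos (by linarith) (by linarith)
  -- the onset window for the cell value `v`
  set T : ℚ := (1 - γb) * (1 - δb) / (4096 * (1 + C)) with hTdef
  have hTpos : 0 < T := by rw [hTdef]; positivity
  have hT1 : T ≤ 1 / 4096 := by
    rw [hTdef, div_le_iff₀ (by positivity)]
    have : (1 - γb) * (1 - δb) ≤ 1 := by nlinarith
    linarith
  have hTC : (1 + C) * T = (1 - γb) * (1 - δb) * (1 / 64 * (1 / 64)) := by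
    rw [hTdef]; field_simp; ring
  obtain ⟨m, hm0, hm224, hm15, hmT⟩ : ∃ m : ℚ, 0 < m ∧ 224 / κ ≤ m ∧ 15 / 1024 ≤ m ∧ m ^ 2 < T := by
    by_cases h : 224 / κ ≤ 15 / 1024
    · refine ⟨15 / 1024, by norm_num, h, le_rfl, ?_⟩
      rw [hTdef, lt_div_iff₀ (by positivity)]
      linarith
    · push Not at h
      refine ⟨224 / κ, div_pos (by norm_num) hκ0, le_rfl, h.le, ?_⟩
      rw [div_pow, div_lt_iff₀ (by positivity), hTdef, div_mul_eq_mul_div, lt_div_iff₀ (by positivity)]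
      linarith
  obtain ⟨v, hmv, hvT⟩ := exists_rat_gt_sq_lt hm0 hmT
  have hv0 : 0 < v := lt_trans hm0 hmv
  have hv15 : 15 / 1024 < v := lt_of_le_of_lt hm15 hmv
  have hv16 : v ≤ 1 / 64 := by nlinarith
  have hκv : 224 < κ * v := by
    have : 224 / κ < v := lt_of_le_of_lt hm224 hmv
    rwa [div_lt_iff₀ hκ0, mul_comm] at this
  -- the numerator `A = min(κ v, 448)`
  set A : ℚ := min (κ * v) 448 with hAdef
  have hA224 : 224 < A := lt_min hκv (by norm_num)
  have hA448 : A ≤ 448 := min_le_right _ _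
  have hAκ : A ≤ κ * v := min_le_left _ _
  have hvA : v ≤ A := by linarith
  have h64 : (roundNE E4M3 v).toRat = 1 / 64 := toRat_roundNE_E4M3_eq_inv64 hv15 hv16
  -- the blocks
  set a' : Fin (n + 3) → ℚ := Fin.cases A (Fin.cases (0 : ℚ) (fun _ : Fin (n + 1) => v)) with ha'
  set b' : Fin (n + 3) → ℚ := Fin.cases (0 : ℚ) (Fin.cases A (fun _ : Fin (n + 1) => v)) with hb'
  obtain ⟨hca, hcb, ha0, hb1⟩ := pinned_class (n := n) hv0 hvA hAκ ha' hb'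
  obtain ⟨hS1, hS1a, hS2, hS3⟩ := pinned_sums (n := n) (A := A) (x := v)
    (fun y : ℚ => (roundNE E4M3 y).toRat) toRat_roundNE_zero ha' hb'
  rw [h64] at hS1 hS1a
  have hBa : blockMax a' = A := blockMax_eq_of_forall_le (fun i => (hca i).1) ha0
  have hBb : blockMax b' = A := blockMax_eq_of_forall_le (fun i => (hcb i).1) hb1
  have hsa : ceilScale E4M3 a' = 1 := by
    have := ceilScale_eq_zpow (φ := E4M3) hMpos (V := a') (e := 0)
      (by rw [hBa, hM]; norm_num; exact hA224) (by rw [hBa, hM]; norm_num; exact hA448)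
    simpa using this
  have hsb : ceilScale E4M3 b' = 1 := by
    have := ceilScale_eq_zpow (φ := E4M3) hMpos (V := b') (e := 0)
      (by rw [hBb, hM]; norm_num; exact hA224) (by rw [hBb, hM]; norm_num; exact hA448)
    simpa using this
  refine ⟨fun _ => a', fun _ => b', A, A, fun _ i => hca i, fun _ i => hcb i, ?_⟩
  intro γ δ acc c hγ hδ hacc hc
  simp only [hsa, hsb, div_one, one_mul, hS1, hS1a, hS2, hS3, sum_const, card_univ, Fintype.card_fin,
    nsmul_eq_mul] at hacc ⊢
  have hN : (0 : ℚ) < (B : ℚ) * ((n + 1 : ℕ) : ℚ) := by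
    have : (0 : ℚ) < (B : ℚ) := by exact_mod_cast hB
    positivity
  have e1 : ((B : ℚ) * (((n + 1 : ℕ) : ℚ) * ((1 : ℚ) / 64 * (1 / 64))) : ℚ)
      = (B : ℚ) * ((n + 1 : ℕ) : ℚ) * (1 / 64 * (1 / 64)) := by ring
  have e2 : ((B : ℚ) * (((n + 1 : ℕ) : ℚ) * |(1 : ℚ) / 64 * (1 / 64)|) : ℚ)
      = (B : ℚ) * ((n + 1 : ℕ) : ℚ) * |(1 : ℚ) / 64 * (1 / 64)| := by ring
  have e3 : ((B : ℚ) * (((n + 1 : ℕ) : ℚ) * (v * v)) : ℚ) = (B : ℚ) * ((n + 1 : ℕ) : ℚ) * (v * v) := by ring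
  have e4 : ((B : ℚ) * (((n + 1 : ℕ) : ℚ) * |v * v|) : ℚ) = (B : ℚ) * ((n + 1 : ℕ) : ℚ) * |v * v| := by ring
  rw [e1, e2] at hacc
  rw [e3, e4]
  have hnum : (C + 1) * (v * v) < (1 - γb) * (1 - δb) * (1 / 64 * (1 / 64)) := by
    rw [← hTC, ← sq, add_comm]
    exact mul_lt_mul_of_pos_left hvT hC1
  exact pipeline_witness_up_of_caps hN (by norm_num) (mul_pos hv0 hv0) hγb hδb hγ hδ hacc hc hnum

/-- **ROW P5 ABOVE THE ONSET `κ_Π` (cell candidate L20a `RowP5OutputOnsetAbove`, for EVERY `κ > κ_Π`).**  At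
the caps `(1/2048, 1/257)`: for every `κ > 0` with `137506330902528 < 591583·κ²` and blocks of length `≥ 3`
an input of `C(κ)` has `C_Π·L < |c - S|` for EVERY realisation of the MX-E4M3-ceil pipeline.  Together with
`row_P5_no_output_witness_below`: the output-level onset of row P5 is EXACTLY `κ_Π`, strictly between the
quantiser-level tie `θ = 258048/17` and `229376/15`.  (`0 < κ` is necessary: `C(κ)` is `{0}` for `κ < 0`.)
[cite: RouhaniEtAl2023MX, §5.1] [cite: MicikeviciusEtAl2022, §3] -/
theorem row_P5_output_onset_above {B k : ℕ} (hB : 0 < B) (hk : 3 ≤ k) {κ : ℚ} (hκ0 : 0 < κ)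
    (hκ : 137506330902528 < 591583 * κ ^ 2) :
    ∃ (a b : Fin B → Fin k → ℚ) (Aa Ab : ℚ),
      (∀ j i, |a j i| ≤ Aa ∧ (a j i = 0 ∨ Aa ≤ κ * |a j i|)) ∧
      (∀ j i, |b j i| ≤ Ab ∧ (b j i = 0 ∨ Ab ≤ κ * |b j i|)) ∧
      ∀ (γ δ acc c : ℚ), γ ≤ 1 / 2048 → δ ≤ 1 / 257 →
        |acc - ∑ j, ∑ i, (ceilScale E4M3 (a j) * (roundNE E4M3 (a j i / ceilScale E4M3 (a j))).toRat) *
            (ceilScale E4M3 (b j) * (roundNE E4M3 (b j i / ceilScale E4M3 (b j))).toRat)|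
          ≤ γ * ∑ j, ∑ i, |(ceilScale E4M3 (a j) * (roundNE E4M3 (a j i / ceilScale E4M3 (a j))).toRat) *
            (ceilScale E4M3 (b j) * (roundNE E4M3 (b j i / ceilScale E4M3 (b j))).toRat)| →
        |c - acc| ≤ δ * |acc| →
        (35 / 289 + 1 / 2048 * (324 / 289) + 1 / 257 * (324 / 289) * (1 + 1 / 2048))
            * ∑ j, ∑ i, |a j i * b j i| < |c - ∑ j, ∑ i, a j i * b j i| :=
  row_P5_output_witness hB hk hκ0 (by norm_num) (by norm_num) (by norm_num) (by norm_num) (by norm_num)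
    (by linarith) (by norm_num)

/-! ## Sharpness of the exact-accumulation MX envelope on the sliver rung -/

/-- **THE RATIO ENVELOPE IS APPROACHED**: for `0 < κ ≤ 229376/15`, every `q ≥ 0` with `(q + 1)·14336² < κ²`
is exceeded on `C(κ)` (blocks of length `≥ 3`, exact accumulation): the pinned input with cell value `v`,
`224/κ < v`, `v² < 1/(4096(q + 1))`, has `q·L < |ΣΣ q̂a q̂b - S|`.  With `mxCeil_blocked_le_ratio` the exact
MX-E4M3-ceil envelope on `258048/17 ≤ κ ≤ 229376/15` is `(κ/14336)² - 1`. [cite: RouhaniEtAl2023MX, §5.1] -/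
theorem mxCeil_ratio_envelope_approached {B k : ℕ} (hB : 0 < B) (hk : 3 ≤ k) {κ q : ℚ} (hκ0 : 0 < κ)
    (hκM : κ ≤ 229376 / 15) (hq0 : 0 ≤ q) (hq : (q + 1) * 14336 ^ 2 < κ ^ 2) :
    ∃ (a b : Fin B → Fin k → ℚ) (Aa Ab : ℚ),
      (∀ j i, |a j i| ≤ Aa ∧ (a j i = 0 ∨ Aa ≤ κ * |a j i|)) ∧
      (∀ j i, |b j i| ≤ Ab ∧ (b j i = 0 ∨ Ab ≤ κ * |b j i|)) ∧
      q * ∑ j, ∑ i, |a j i * b j i| <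
        |∑ j, ∑ i, (ceilScale E4M3 (a j) * (roundNE E4M3 (a j i / ceilScale E4M3 (a j))).toRat) *
            (ceilScale E4M3 (b j) * (roundNE E4M3 (b j i / ceilScale E4M3 (b j))).toRat)
          - ∑ j, ∑ i, a j i * b j i| := by
  obtain ⟨n, rfl⟩ : ∃ n, k = n + 3 := ⟨k - 3, by omega⟩
  have hM : E4M3.maxRat = 448 := by decide +kernel
  have hMpos : 0 < E4M3.maxRat := by rw [hM]; norm_num
  have hq1 : 0 < q + 1 := by linarith
  set T : ℚ := 1 / (4096 * (q + 1)) with hTdef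
  have hT1 : T ≤ 1 / 4096 := by
    rw [hTdef, div_le_iff₀ (by positivity)]
    have : (1 : ℚ) ≤ q + 1 := by linarith
    nlinarith
  have hmT : (224 / κ) ^ 2 < T := by
    rw [div_pow, div_lt_iff₀ (by positivity), hTdef, div_mul_eq_mul_div, lt_div_iff₀ (by positivity)]
    linarith
  obtain ⟨v, hmv, hvT⟩ := exists_rat_gt_sq_lt (div_pos (by norm_num) hκ0) hmT
  have hm15 : 15 / 1024 ≤ 224 / κ := by
    rw [le_div_iff₀ hκ0]; linarith
  have hv0 : 0 < v := lt_trans (div_pos (by norm_num) hκ0) hmv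
  have hv15 : 15 / 1024 < v := lt_of_le_of_lt hm15 hmv
  have hv16 : v ≤ 1 / 64 := by nlinarith
  have hκv : 224 < κ * v := by rwa [div_lt_iff₀ hκ0, mul_comm] at hmv
  have hκv448 : κ * v ≤ 448 := by nlinarith
  have hvA : v ≤ κ * v := by linarith
  have h64 : (roundNE E4M3 v).toRat = 1 / 64 := toRat_roundNE_E4M3_eq_inv64 hv15 hv16
  set a' : Fin (n + 3) → ℚ := Fin.cases (κ * v) (Fin.cases (0 : ℚ) (fun _ : Fin (n + 1) => v)) with ha'
  set b' : Fin (n + 3) → ℚ := Fin.cases (0 : ℚ) (Fin.cases (κ * v) (fun _ : Fin (n + 1) => v)) with hb'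
  obtain ⟨hca, hcb, ha0, hb1⟩ := pinned_class (n := n) hv0 hvA le_rfl ha' hb'
  obtain ⟨hS1, hS1a, hS2, hS3⟩ := pinned_sums (n := n) (A := κ * v) (x := v)
    (fun y : ℚ => (roundNE E4M3 y).toRat) toRat_roundNE_zero ha' hb'
  rw [h64] at hS1 hS1a
  have hBa : blockMax a' = κ * v := blockMax_eq_of_forall_le (fun i => (hca i).1) ha0
  have hBb : blockMax b' = κ * v := blockMax_eq_of_forall_le (fun i => (hcb i).1) hb1
  have hsa : ceilScale E4M3 a' = 1 := by
    have := ceilScale_eq_zpow (φ := E4M3) hMpos (V := a') (e := 0)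
      (by rw [hBa, hM]; norm_num; exact hκv) (by rw [hBa, hM]; norm_num; exact hκv448)
    simpa using this
  have hsb : ceilScale E4M3 b' = 1 := by
    have := ceilScale_eq_zpow (φ := E4M3) hMpos (V := b') (e := 0)
      (by rw [hBb, hM]; norm_num; exact hκv) (by rw [hBb, hM]; norm_num; exact hκv448)
    simpa using this
  refine ⟨fun _ => a', fun _ => b', κ * v, κ * v, fun _ i => hca i, fun _ i => hcb i, ?_⟩
  simp only [hsa, hsb, div_one, one_mul, hS1, hS2, hS3, sum_const, card_univ, Fintype.card_fin,
    nsmul_eq_mul]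
  have hN : (0 : ℚ) < (B : ℚ) * ((n + 1 : ℕ) : ℚ) := by
    have : (0 : ℚ) < (B : ℚ) := by exact_mod_cast hB
    positivity
  have e2 : ((B : ℚ) * (((n + 1 : ℕ) : ℚ) * ((1 : ℚ) / 64 * (1 / 64))) : ℚ)
      - (B : ℚ) * (((n + 1 : ℕ) : ℚ) * (v * v)) = (B : ℚ) * ((n + 1 : ℕ) : ℚ) * (1 / 64 * (1 / 64) - v * v) := by
    ring
  have e4 : ((B : ℚ) * (((n + 1 : ℕ) : ℚ) * |v * v|) : ℚ) = (B : ℚ) * ((n + 1 : ℕ) : ℚ) * (v * v) := by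
    rw [abs_of_pos (mul_pos hv0 hv0)]; ring
  rw [e2, e4]
  have hcell : q * (v * v) < 1 / 64 * (1 / 64) - v * v := by
    have h1 : (q + 1) * (v * v) < (q + 1) * T := by rw [← sq]; exact mul_lt_mul_of_pos_left hvT hq1
    have h2 : (q + 1) * T = 1 / 64 * (1 / 64) := by rw [hTdef]; field_simp; ring
    linarith
  have hpos : 0 < 1 / 64 * (1 / 64) - v * v := by nlinarith
  rw [abs_of_pos (mul_pos hN hpos)]
  have := mul_lt_mul_of_pos_left hcell hN
  linarith

end Summit.Ventures.CertifiedArithmetic.LowPrec.GemmEnvelope
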